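import Mathlib
import Literature.Analysis.InnerProduct.SchurInequality
import Literature.Probability.LatticeModels.SlitPlaneAsymptotics
import Literature.NumberTheory.Sieve.MatomakiRadziwillLemma4Lipschitz
import Summits.QuantumFields.QCD.Theorems.QuarksAsStableActionCriticalLineDiamagnetismStubLogDetSecondOrder

/-!
# Dimension-free log-determinant bounds
(helper for crux stmt-QuantumFields-9307, line `registered`, stub `stub_logDetDimFree`, G1)

Abstract finite-dimensional linear algebra over `ℂ` (no lattice objects).  For a complex square
matrix `R` on a finite index type `ι` write `‖R‖_F² = Σ_{ij} ‖R i j‖²`.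

* (a) If `Σᵢ ‖(R v)ᵢ‖² ≤ ρ² Σᵢ ‖vᵢ‖²` for all `v` with `0 ≤ ρ ≤ 1/2`, and `‖R‖_F² ≤ F`, then

    `‖det (1 + R)‖ ≤ exp (Re tr R − ½ Re tr R² + 2 ρ F)`.

* (b) For EVERY `R` with `‖R‖_F² ≤ F`, `‖det (1 + R)‖ ≤ exp (Re tr R + F / 2)`.

Compared with the sibling crux's `stub_logDetSecondOrder`
(`Theorems/QuarksAsStableActionCriticalLineDiamagnetismStubLogDetSecondOrder.lean`, remainder
`2 |ι| ρ³`) and `stub_detPerturbIR` (remainder `√|ι| …`), the dimension `|ι|` is gone: the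
remainders are paid in the Frobenius norm through **Schur's inequality**
`Σ_{x ∈ roots χ_R} |x|² ≤ ‖R‖_F²` (`Literature.Analysis.InnerProduct.matrix_sum_norm_sq_roots_charpoly_le`).

Proof.  Let `x` run over the roots of the characteristic polynomial of `R` (with multiplicity)
and `y` over those of `R²`.
(b) `det (1 + R) = Π (1 + x)` and `‖1 + x‖² = 1 + 2 Re x + ‖x‖² ≤ exp (2 Re x + ‖x‖²)`
(`1 + u ≤ eᵘ`, valid for every `x`, also when `1 + x = 0`), so `‖det (1 + R)‖ ≤ exp (Σ Re x + ½ Σ ‖x‖²) ≤ exp (Re tr R + F/2)` by Schur.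
(a) As in the sibling file, `2 log ‖det (1 + R)‖ = Σ_y log ‖1 − y‖ + Σ_x (log ‖1 + x‖ − log ‖1 − x‖)`
with `‖x‖ ≤ ρ`, `‖y‖ ≤ ρ²` (operator bound on eigenvectors).  Even part, root by root:
`log ‖1 − y‖ ≤ −Re y + ‖y‖²/2` (again `1 + u ≤ eᵘ`), and
`Σ_y ‖y‖² ≤ ‖R²‖_F² ≤ ρ² ‖R‖_F² ≤ ρ² F` (Schur for `R²`, then the operator bound column by
column).  Odd part, root by root: the quadratic Taylor terms of `log (1 ± x)` cancel and each cubic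
remainder is `≤ ‖x‖³ / (3 (1 − ‖x‖)) ≤ (2/3) ‖x‖³ ≤ (2/3) ρ ‖x‖²`
(`Literature.Probability.LatticeModels.norm_log_one_add_sub_le`), so
`log ‖1 + x‖ − log ‖1 − x‖ ≤ 2 Re x + (4/3) ρ ‖x‖²` and `Σ_x ‖x‖² ≤ F` (Schur).  Summing and halving,
`log ‖det (1 + R)‖ ≤ Re tr R − ½ Re tr R² + ρ² F/4 + (2/3) ρ F ≤ … + 2 ρ F` (`ρ² ≤ ρ/2`, `F ≥ 0`).

Reuses the sibling file's exported lemmas (`norm_root_charpoly_le`, `det_one_add_eq_prod_coe`,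
`det_one_sub_eq_prod_coe`, `trace_re_eq_sum_coe`, `norm_one_add_pos`, `norm_one_sub_pos`) and the
tree's scalar lemma `‖1 + z‖ ≤ exp (Re z + ‖z‖²/2)`
(`Literature.NumberTheory.Sieve.MatomakiRadziwillL4A.norm_one_add_le_exp`, imported rather than
restated).  Pure theorem file (no definitions); Mathlib + the three Literature files + the sibling
file only.
-/

noncomputable section

open scoped BigOperators Classical Matrix ComplexConjugate
open Finset

namespace Summit.QuantumFields.QCD.Cruxes.FlatCellOptimal

namespace LogDetDimFree

open Literature.Analysis.InnerProduct
open Summit.QuantumFields.QCD.Cruxes.CriticalLineDiamagnetism.ChessboardCellGain.LogDetSecondOrder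

variable {ι : Type*} [Fintype ι] [DecidableEq ι]

/-! ## Scalar estimates -/

/-- **Even part, root by root, with `‖y‖²` kept**: `log ‖1 − y‖ ≤ −Re y + ‖y‖² / 2` for
`‖y‖ < 1` (from the tree's `‖1 + z‖ ≤ exp (Re z + ‖z‖²/2)`,
`Literature.NumberTheory.Sieve.MatomakiRadziwillL4A.norm_one_add_le_exp`, i.e. `1 + u ≤ eᵘ`). -/
theorem log_norm_one_sub_le_sq {y : ℂ} (hy : ‖y‖ < 1) :
    Real.log ‖1 - y‖ ≤ -y.re + ‖y‖ ^ 2 / 2 := by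
  rw [Real.log_le_iff_le_exp (norm_one_sub_pos hy), sub_eq_add_neg]
  have h := Literature.NumberTheory.Sieve.MatomakiRadziwillL4A.norm_one_add_le_exp (-y)
  rwa [norm_neg, Complex.neg_re] at h

/-- **Odd part, root by root, with `‖x‖²` kept**: for `‖x‖ ≤ ρ ≤ 1/2`,
`log ‖1 + x‖ − log ‖1 − x‖ ≤ 2 Re x + (4/3) ρ ‖x‖²` (the quadratic Taylor terms of `log (1 ± x)`
cancel, each cubic remainder is at most `‖x‖³ / (3 (1 − ‖x‖)) ≤ (2/3) ‖x‖³`, and `‖x‖³ ≤ ρ ‖x‖²`). -/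
theorem log_norm_one_add_sub_log_norm_one_sub_le_sq {x : ℂ} {ρ : ℝ} (hρ : ρ ≤ 1 / 2)
    (hx : ‖x‖ ≤ ρ) :
    Real.log ‖1 + x‖ - Real.log ‖1 - x‖ ≤ 2 * x.re + 4 / 3 * ρ * ‖x‖ ^ 2 := by
  have hx2 : ‖x‖ ≤ 1 / 2 := hx.trans hρ
  have hx0 : 0 ≤ ‖x‖ := norm_nonneg x
  have hx1 : ‖x‖ < 1 := by linarith
  have hx1' : ‖-x‖ < 1 := by rwa [norm_neg]
  -- cubic Taylor bounds `‖log (1 + z) − (z − z²/2)‖ ≤ ‖z‖³ / (3 (1 − ‖z‖))` at `z = ± x`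
  have hp := Literature.Probability.LatticeModels.norm_log_one_add_sub_le hx1
  have hm := Literature.Probability.LatticeModels.norm_log_one_add_sub_le hx1'
  rw [norm_neg, neg_sq, ← sub_eq_add_neg] at hm
  have hw : (1 - ‖x‖)⁻¹ ≤ 2 := by rw [inv_le_comm₀ (by linarith) two_pos]; linarith
  have hwnn : 0 ≤ (1 - ‖x‖)⁻¹ := inv_nonneg.mpr (by linarith)
  have hx3 : ‖x‖ ^ 3 ≤ ρ * ‖x‖ ^ 2 := by
    rw [pow_succ']
    exact mul_le_mul_of_nonneg_right hx (sq_nonneg _)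
  have hρx : 0 ≤ ρ * ‖x‖ ^ 2 := mul_nonneg (hx0.trans hx) (sq_nonneg _)
  have h4 : ‖x‖ ^ 3 * (1 - ‖x‖)⁻¹ ≤ ρ * ‖x‖ ^ 2 * 2 := mul_le_mul hx3 hw hwnn hρx
  have hid : Real.log ‖1 + x‖ - Real.log ‖1 - x‖ = 2 * x.re +
      ((Complex.log (1 + x) - (x - x ^ 2 / 2)) -
        (Complex.log (1 - x) - (-x - x ^ 2 / 2))).re := by
    simp only [Complex.sub_re, Complex.neg_re, Complex.log_re]; ring
  have hre := Complex.re_le_norm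
    ((Complex.log (1 + x) - (x - x ^ 2 / 2)) - (Complex.log (1 - x) - (-x - x ^ 2 / 2)))
  have hns := norm_sub_le (Complex.log (1 + x) - (x - x ^ 2 / 2))
    (Complex.log (1 - x) - (-x - x ^ 2 / 2))
  rw [hid]
  linarith

/-! ## Frobenius sums -/

/-- **Schur's inequality** over the roots as a finite type:
`Σ_{x : roots χ_M} ‖x‖² ≤ Σ_{ij} ‖M i j‖²`. -/
theorem sum_norm_sq_coe_roots_le (M : Matrix ι ι ℂ) :
    ∑ x : M.charpoly.roots, ‖(x : ℂ)‖ ^ 2 ≤ ∑ i, ∑ j, ‖M i j‖ ^ 2 := by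
  rw [Finset.sum_eq_multiset_sum, Multiset.map_univ _ (fun z : ℂ => ‖z‖ ^ 2)]
  exact matrix_sum_norm_sq_roots_charpoly_le M

omit [DecidableEq ι] in
/-- `‖R R‖_F² ≤ ρ² ‖R‖_F²` from the operator bound applied to the columns of `R`. -/
theorem sum_norm_sq_mul_self_le (R : Matrix ι ι ℂ) {ρ : ℝ}
    (hR : ∀ v : ι → ℂ, ∑ i, ‖(R.mulVec v) i‖ ^ 2 ≤ ρ ^ 2 * ∑ i, ‖v i‖ ^ 2) :
    ∑ i, ∑ j, ‖(R * R) i j‖ ^ 2 ≤ ρ ^ 2 * ∑ i, ∑ j, ‖R i j‖ ^ 2 := by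
  rw [Finset.sum_comm, Finset.sum_comm (f := fun i j => ‖R i j‖ ^ 2), Finset.mul_sum]
  refine Finset.sum_le_sum fun j _ => ?_
  have hcol : ∀ i, (R * R) i j = (R.mulVec fun l => R l j) i := fun i => by
    simp [Matrix.mul_apply, Matrix.mulVec, dotProduct]
  simp_rw [hcol]
  exact hR _

/-! ## The two bounds -/

/-- **(a) Second-order bound with Frobenius remainder**: for `Σᵢ ‖(R v)ᵢ‖² ≤ ρ² Σᵢ ‖vᵢ‖²`
(`0 ≤ ρ ≤ 1/2`) and `‖R‖_F² ≤ F`, `‖det (1 + R)‖ ≤ exp (Re tr R − ½ Re tr R² + 2 ρ F)`. -/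
theorem norm_det_one_add_le_of_opBound (R : Matrix ι ι ℂ) {ρ F : ℝ} (hρ0 : 0 ≤ ρ)
    (hρ : ρ ≤ 1 / 2) (hR : ∀ v : ι → ℂ, ∑ i, ‖(R.mulVec v) i‖ ^ 2 ≤ ρ ^ 2 * ∑ i, ‖v i‖ ^ 2)
    (hF : ∑ i, ∑ j, ‖R i j‖ ^ 2 ≤ F) :
    ‖(1 + R).det‖ ≤ Real.exp (R.trace.re - (R * R).trace.re / 2 + 2 * ρ * F) := by
  have hρ1 : ρ < 1 := by linarith
  have hρ21 : ρ ^ 2 < 1 := by nlinarith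
  have hF0 : 0 ≤ F := le_trans (by positivity) hF
  -- the operator bound for `R * R`
  have hRR : ∀ v : ι → ℂ, ∑ i, ‖((R * R).mulVec v) i‖ ^ 2 ≤ (ρ ^ 2) ^ 2 * ∑ i, ‖v i‖ ^ 2 := by
    intro v
    rw [← Matrix.mulVec_mulVec]
    calc ∑ i, ‖(R.mulVec (R.mulVec v)) i‖ ^ 2 ≤ ρ ^ 2 * ∑ i, ‖(R.mulVec v) i‖ ^ 2 := hR _
      _ ≤ ρ ^ 2 * (ρ ^ 2 * ∑ i, ‖v i‖ ^ 2) := mul_le_mul_of_nonneg_left (hR v) (sq_nonneg _)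
      _ = (ρ ^ 2) ^ 2 * ∑ i, ‖v i‖ ^ 2 := by ring
  -- eigenvalue bounds
  have hs : ∀ x : R.charpoly.roots, ‖(x : ℂ)‖ ≤ ρ := fun x =>
    norm_root_charpoly_le R hρ0 hR Multiset.coe_mem
  have ht : ∀ y : (R * R).charpoly.roots, ‖(y : ℂ)‖ ≤ ρ ^ 2 := fun y =>
    norm_root_charpoly_le (R * R) (sq_nonneg ρ) hRR Multiset.coe_mem
  have hp_pos : ∀ x : R.charpoly.roots, 0 < ‖1 + (x : ℂ)‖ := fun x =>
    norm_one_add_pos ((hs x).trans_lt hρ1)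
  have hm_pos : ∀ x : R.charpoly.roots, 0 < ‖1 - (x : ℂ)‖ := fun x =>
    norm_one_sub_pos ((hs x).trans_lt hρ1)
  have ht_pos : ∀ y : (R * R).charpoly.roots, 0 < ‖1 - (y : ℂ)‖ := fun y =>
    norm_one_sub_pos ((ht y).trans_lt hρ21)
  -- the three determinants as products over roots, and their logarithms
  have ha : 0 < ‖(1 + R).det‖ := by
    rw [det_one_add_eq_prod_coe, norm_prod]
    exact Finset.prod_pos fun x _ => hp_pos x
  have hb : 0 < ‖(1 - R).det‖ := by
    rw [det_one_sub_eq_prod_coe, norm_prod]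
    exact Finset.prod_pos fun x _ => hm_pos x
  have hlog_p : Real.log ‖(1 + R).det‖ = ∑ x : R.charpoly.roots, Real.log ‖1 + (x : ℂ)‖ := by
    rw [det_one_add_eq_prod_coe, norm_prod, Real.log_prod fun x _ => (hp_pos x).ne']
  have hlog_m : Real.log ‖(1 - R).det‖ = ∑ x : R.charpoly.roots, Real.log ‖1 - (x : ℂ)‖ := by
    rw [det_one_sub_eq_prod_coe, norm_prod, Real.log_prod fun x _ => (hm_pos x).ne']
  have hlog_t : Real.log ‖(1 - R * R).det‖ =
      ∑ y : (R * R).charpoly.roots, Real.log ‖1 - (y : ℂ)‖ := by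
    rw [det_one_sub_eq_prod_coe, norm_prod, Real.log_prod fun y _ => (ht_pos y).ne']
  -- `(1 + R)(1 - R) = 1 - R²`, so `2 log a = log ‖det (1 - R²)‖ + (log a - log b)`
  have hmul : ‖(1 + R).det‖ * ‖(1 - R).det‖ = ‖(1 - R * R).det‖ := by
    rw [← norm_mul, ← Matrix.det_mul]
    congr 2
    noncomm_ring
  have hkey : 2 * Real.log ‖(1 + R).det‖ = Real.log ‖(1 - R * R).det‖ +
      (Real.log ‖(1 + R).det‖ - Real.log ‖(1 - R).det‖) := by
    rw [← hmul, Real.log_mul ha.ne' hb.ne']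
    ring
  -- Schur sums
  have hSx : ∑ x : R.charpoly.roots, ‖(x : ℂ)‖ ^ 2 ≤ F := (sum_norm_sq_coe_roots_le R).trans hF
  have hSy : ∑ y : (R * R).charpoly.roots, ‖(y : ℂ)‖ ^ 2 ≤ ρ ^ 2 * F :=
    (sum_norm_sq_coe_roots_le (R * R)).trans
      ((sum_norm_sq_mul_self_le R hR).trans (mul_le_mul_of_nonneg_left hF (sq_nonneg _)))
  -- even part
  have heven : Real.log ‖(1 - R * R).det‖ ≤ -(R * R).trace.re + ρ ^ 2 * F / 2 := by
    rw [hlog_t, trace_re_eq_sum_coe (R * R)]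
    calc ∑ y : (R * R).charpoly.roots, Real.log ‖1 - (y : ℂ)‖
        ≤ ∑ y : (R * R).charpoly.roots, (-(y : ℂ).re + ‖(y : ℂ)‖ ^ 2 / 2) :=
          Finset.sum_le_sum fun y _ => log_norm_one_sub_le_sq ((ht y).trans_lt hρ21)
      _ = -∑ y : (R * R).charpoly.roots, (y : ℂ).re
            + (∑ y : (R * R).charpoly.roots, ‖(y : ℂ)‖ ^ 2) / 2 := by
          rw [Finset.sum_add_distrib, Finset.sum_neg_distrib, Finset.sum_div]
      _ ≤ _ := by linarith [hSy]
  -- odd part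
  have hodd : Real.log ‖(1 + R).det‖ - Real.log ‖(1 - R).det‖ ≤
      2 * R.trace.re + 4 / 3 * ρ * F := by
    rw [hlog_p, hlog_m, ← Finset.sum_sub_distrib, trace_re_eq_sum_coe R]
    calc ∑ x : R.charpoly.roots, (Real.log ‖1 + (x : ℂ)‖ - Real.log ‖1 - (x : ℂ)‖)
        ≤ ∑ x : R.charpoly.roots, (2 * (x : ℂ).re + 4 / 3 * ρ * ‖(x : ℂ)‖ ^ 2) :=
          Finset.sum_le_sum fun x _ => log_norm_one_add_sub_log_norm_one_sub_le_sq hρ (hs x)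
      _ = 2 * ∑ x : R.charpoly.roots, (x : ℂ).re
            + 4 / 3 * ρ * ∑ x : R.charpoly.roots, ‖(x : ℂ)‖ ^ 2 := by
          rw [Finset.sum_add_distrib, ← Finset.mul_sum, ← Finset.mul_sum]
      _ ≤ _ := by
          have h43 : 4 / 3 * ρ * ∑ x : R.charpoly.roots, ‖(x : ℂ)‖ ^ 2 ≤ 4 / 3 * ρ * F :=
            mul_le_mul_of_nonneg_left hSx (by positivity)
          linarith
  -- combine and exponentiate
  have hρ2 : ρ ^ 2 * F ≤ ρ / 2 * F := by
    refine mul_le_mul_of_nonneg_right ?_ hF0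
    nlinarith
  have hρF : 0 ≤ ρ * F := mul_nonneg hρ0 hF0
  have hlog : Real.log ‖(1 + R).det‖ ≤ R.trace.re - (R * R).trace.re / 2 + 2 * ρ * F := by
    linarith
  calc ‖(1 + R).det‖ = Real.exp (Real.log ‖(1 + R).det‖) := (Real.exp_log ha).symm
    _ ≤ _ := Real.exp_le_exp.mpr hlog

/-- **(b) Crude bound**: for every `R` with `‖R‖_F² ≤ F`, `‖det (1 + R)‖ ≤ exp (Re tr R + F / 2)`
(`‖1 + x‖ ≤ exp (Re x + ‖x‖²/2)` root by root, then Schur). -/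
theorem norm_det_one_add_le_exp_trace_add (R : Matrix ι ι ℂ) {F : ℝ}
    (hF : ∑ i, ∑ j, ‖R i j‖ ^ 2 ≤ F) : ‖(1 + R).det‖ ≤ Real.exp (R.trace.re + F / 2) := by
  rw [det_one_add_eq_prod_coe, norm_prod]
  calc ∏ x : R.charpoly.roots, ‖1 + (x : ℂ)‖
      ≤ ∏ x : R.charpoly.roots, Real.exp ((x : ℂ).re + ‖(x : ℂ)‖ ^ 2 / 2) :=
        Finset.prod_le_prod (fun x _ => norm_nonneg _) fun x _ =>
          Literature.NumberTheory.Sieve.MatomakiRadziwillL4A.norm_one_add_le_exp _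
    _ = Real.exp (∑ x : R.charpoly.roots, ((x : ℂ).re + ‖(x : ℂ)‖ ^ 2 / 2)) :=
        (Real.exp_sum _ _).symm
    _ ≤ Real.exp (R.trace.re + F / 2) := by
        rw [Real.exp_le_exp, Finset.sum_add_distrib, ← Finset.sum_div, ← trace_re_eq_sum_coe R]
        have h := sum_norm_sq_coe_roots_le R
        linarith

/-! ## The registered stub -/

/-- **Dimension-free log-determinant bounds** (registered stub `stub_logDetDimFree`, G1, of the
line `registered` of crux `FlatCellOptimal`): (a) for `Σᵢ ‖(R v)ᵢ‖² ≤ ρ² Σᵢ ‖vᵢ‖²`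
(`0 ≤ ρ ≤ 1/2`) and `‖R‖_F² ≤ F`, `‖det (1 + R)‖ ≤ exp (Re tr R − ½ Re tr R² + 2 ρ F)`;
(b) for every `R` with `‖R‖_F² ≤ F`, `‖det (1 + R)‖ ≤ exp (Re tr R + F / 2)`. -/
theorem stub_logDetDimFree : (∀ {ι : Type} [Fintype ι] [DecidableEq ι] (R : Matrix ι ι ℂ) (ρ F : ℝ), 0 ≤ ρ → ρ ≤ 1 / 2 → (∀ v : ι → ℂ, ∑ i, ‖(R.mulVec v) i‖ ^ 2 ≤ ρ ^ 2 * ∑ i, ‖v i‖ ^ 2) → (∑ i, ∑ j, ‖R i j‖ ^ 2 ≤ F) → ‖(1 + R).det‖ ≤ Real.exp (R.trace.re - (R * R).trace.re / 2 + 2 * ρ * F)) ∧ (∀ {ι : Type} [Fintype ι] [DecidableEq ι] (R : Matrix ι ι ℂ) (F : ℝ), (∑ i, ∑ j, ‖R i j‖ ^ 2 ≤ F) → ‖(1 + R).det‖ ≤ Real.exp (R.trace.re + F / 2)) :=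
  ⟨fun R _ _ hρ0 hρ hR hF => norm_det_one_add_le_of_opBound R hρ0 hρ hR hF,
    fun R _ hF => norm_det_one_add_le_exp_trace_add R hF⟩

end LogDetDimFree

end Summit.QuantumFields.QCD.Cruxes.FlatCellOptimal

end
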